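import Literature.NumberTheory.Weil1964.AdelicMetaplecticSeesawSum
import HarnessLib

/-!
# A see-saw character trivial at the parabolic points of a RIGID member is trivial on that member

Generic bookkeeping for the see-saw characters of `AdelicMetaplecticSeesawSum` on a PRODUCT group `P₁ × P₂`
(S. Kudla, *Seesaw dual reductive pairs* (1984) §1; S. Gelbart, J. Rogawski, Invent. Math. 105 (1991) §3.1 Remark p. 457:
compatible splittings differ by a character): for a see-saw triple `(S, s₁ ∘ pr₁, s₂ ∘ pr₂)` along `e : κ ≃ κ₁ ⊕ κ₂`
(`mpSeesawCharSum e hT S (s₁ ∘ pr₁) (s₂ ∘ pr₂) hS hT₁ hT₂ : P₁ × P₂ →* ℂˣ`), if the character is `1` at the points `(q, 1)`,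
`q ∈ Q₁` («parabolic points», hypothesis `hQ`), the three homomorphisms are continuous, and `P₁` is RIGID for `Q₁` (every
continuous character of `P₁` trivial on `Q₁` is trivial — hypothesis `hrigid`), then it is `1` on all of `P₁ × {1}`
(`mpSeesawCharSum_inl_eq_one_of_rigid`).  Used with `P_j :=` the doubled unitary groups `H(V_j)(𝔸)` of
[GelbartRogawski1991, §3.1 Prop. 3.1.1], `Q₁ :=` the Siegel parabolic points and `hrigid :=` the rigidity of the
`χ`-normalised doubled Weil representation (`GelbartRogawski1991/DoubledSeesawCharacterRigid`).

References: [Kudla1984] S. Kudla, Progr. Math. 46 (1984) §1; [GelbartRogawski1991] Invent. Math. 105 (1991) §3.1 Remark p. 457.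
-/

set_option autoImplicit false

noncomputable section

open scoped Matrix
open NumberField IsDedekindDomain
open Literature.NumberTheory.Automorphic

namespace Literature.NumberTheory.Weil1964

variable {F : Type} [Field F] [NumberField F] {κ κ₁ κ₂ : Type} [Fintype κ] [DecidableEq κ] [Fintype κ₁]
  [DecidableEq κ₁] [Fintype κ₂] [DecidableEq κ₂] (e : κ ≃ κ₁ ⊕ κ₂)
  {T : Matrix κ κ (AdeleRing (𝓞 F) F)} {T₁ : Matrix κ₁ κ₁ (AdeleRing (𝓞 F) F)} {T₂ : Matrix κ₂ κ₂ (AdeleRing (𝓞 F) F)}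
  (hT : Matrix.reindex e e T = Matrix.fromBlocks T₁ 0 0 T₂)
  {P₁ P₂ : Type*} [Group P₁] [Group P₂] [TopologicalSpace P₁] [TopologicalSpace P₂]
  (S : P₁ × P₂ →* adelicMpCont F κ T) (s₁ : P₁ →* adelicMpCont F κ₁ T₁) (s₂ : P₂ →* adelicMpCont F κ₂ T₂)
  (hS : ∀ p : P₁ × P₂,
    (UnitaryGroup.spReindex e T (adelicMpCont.proj F κ T (S p))).1 =
      (UnitaryGroup.spSum T₁ T₂ (adelicMpCont.proj F κ₁ T₁ ((s₁.comp (MonoidHom.fst P₁ P₂)) p),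
        adelicMpCont.proj F κ₂ T₂ ((s₂.comp (MonoidHom.snd P₁ P₂)) p))).1)
  (hT₁ : IsUnit T₁) (hT₂ : IsUnit T₂)

set_option maxHeartbeats 800000 in
-- (the `mpSeesawCharSum` telescope over a product group; measured ∈ (200 k, 400 k])
/-- **See-saw bookkeeping**: if the see-saw character of `(S, s₁ ∘ pr₁, s₂ ∘ pr₂)` is `1` at every `(q, 1)` with `q` in a
set `Q₁` of «parabolic points» of `P₁`, the three homomorphisms are continuous, and `P₁` is RIGID for `Q₁` (every continuous
character of `P₁` trivial on `Q₁` is trivial), then the see-saw character is `1` on `P₁ × {1}`. [cite: Kudla1984, §1]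
[cite: GelbartRogawski1991, §3.1 Remark p. 457] -/
theorem mpSeesawCharSum_inl_eq_one_of_rigid (hc : Continuous S) (hc₁ : Continuous s₁) (hc₂ : Continuous s₂)
    (Q₁ : Set P₁)
    (hQ : ∀ q ∈ Q₁, mpSeesawCharSum e hT S (s₁.comp (MonoidHom.fst P₁ P₂)) (s₂.comp (MonoidHom.snd P₁ P₂))
      hS hT₁ hT₂ (q, 1) = 1)
    (hrigid : ∀ η : P₁ →* ℂˣ, (Continuous fun p => ((η p : ℂˣ) : ℂ)) → (∀ q ∈ Q₁, η q = 1) → η = 1)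
    (p₁ : P₁) :
    mpSeesawCharSum e hT S (s₁.comp (MonoidHom.fst P₁ P₂)) (s₂.comp (MonoidHom.snd P₁ P₂)) hS hT₁ hT₂ (p₁, 1) = 1 := by
  have hcont : Continuous fun p : P₁ × P₂ =>
      ((mpSeesawCharSum e hT S (s₁.comp (MonoidHom.fst P₁ P₂)) (s₂.comp (MonoidHom.snd P₁ P₂)) hS hT₁ hT₂ p : ℂˣ) : ℂ) :=
    continuous_mpSeesawCharSum e hT S _ _ hS hT₁ hT₂ hc (hc₁.comp continuous_fst) (hc₂.comp continuous_snd)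
  have hη := hrigid
    ((mpSeesawCharSum e hT S (s₁.comp (MonoidHom.fst P₁ P₂)) (s₂.comp (MonoidHom.snd P₁ P₂)) hS hT₁ hT₂).comp
      (MonoidHom.inl P₁ P₂))
    (hcont.comp (continuous_id.prodMk continuous_const)) (fun q hq => hQ q hq)
  have h := DFunLike.congr_fun hη p₁
  rwa [MonoidHom.comp_apply, MonoidHom.inl_apply, MonoidHom.one_apply] at h

end Literature.NumberTheory.Weil1964

end
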